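import Summits.BirchSwinnertonDyer.BirchSwinnertonDyer.Theses.TwoAdicConverse
import Summits.BirchSwinnertonDyer.BirchSwinnertonDyer.Theorems.TwoAdicConverseLambdaHalfDefs
import Literature.NumberTheory.EllipticCurves.KatoKolyvaginPrimes
import Literature.NumberTheory.EllipticCurves.KuriharaNumber
import Literature.NumberTheory.EllipticCurves.IwasawaAlgebraCharIdealProofs
import HarnessLib

/-! # Sketch — crux idea `two-power-slack-rigidity-two` (crux-ideate GEN 7, ideator 1, item stmt-BirchSwinnertonDyer-19556)

First lemma(s) of the line «Kolyvagin-system rigidity with 2-power slack»: the crux `OrdLambdaHalfAtTwo` is the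
ERROR-BLIND shadow of the 2-adic main conjecture (λ ignores every bounded 2-power index), so the Kolyvagin-system
argument for Kato's system at `p = 2` may be run in the error-tolerant form (Castella–Grossi–Lee–Skinner 2022 §3 /
Castella 2024 §2.3, there `p` odd, anticyclotomic, residually reducible): divisibilities in `Λ[1/2]`, no image
hypothesis, no `μ`, no period. Typed objects only; nothing asserted; no `sorry`. -/

set_option linter.dupNamespace false
set_option autoImplicit false

noncomputable section

open scoped Classical MatrixGroups ModularForm
open CongruenceSubgroup WeierstrassCurve Literature.NumberTheory.EllipticCurves
  Literature.NumberTheory.EllipticCurves.ModularForms Literature.NumberTheory.EllipticCurves.Rank1Residual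
  Summit.BirchSwinnertonDyer.BirchSwinnertonDyer.Theorems.TwoAdicTwistConverse
open Literature.NumberTheory.DiophantineGeometry.Dioph (ratModP)

namespace Summit.BirchSwinnertonDyer.BirchSwinnertonDyer.Cruxes.OrdLambdaHalfAtTwo.TwoPowerSlackRigidityTwo

/-- The `c`-scaled Kurihara number at `2` (scaling repairs half-integral plus symbols, typical on the reducible habitat):
`δ^{(c)}_n = ∑_{a ∈ (ℤ/n)ˣ} \overline{c·[a/n]⁺_f} · ∏_{ℓ ∣ n} ψ_ℓ(a) ∈ ℤ/2^k`; at `c = 1` it is the tree's `kuriharaNumber f (2^k) n ψ`. -/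
def kuriharaNumberScaled {N : ℕ} (f : CuspForm (Gamma0 N) 2) (c : ℚ) (k n : ℕ) [NeZero n]
    (ψ : (ℓ : ℕ) → (ZMod ℓ)ˣ →* Multiplicative (ZMod (2 ^ k))) : ZMod (2 ^ k) :=
  ∑ a : (ZMod n)ˣ, ratModP (2 ^ k) (c * ratPlusSymbol f (((a : ZMod n).val : ℚ) / n)) *
    ∏ ℓ ∈ n.primeFactors.attach,
      Multiplicative.toAdd (ψ ℓ.1 (ZMod.unitsMap (Nat.dvd_of_mem_primeFactors ℓ.2) a))

theorem kuriharaNumberScaled_one {N : ℕ} (f : CuspForm (Gamma0 N) 2) (k n : ℕ) [NeZero n]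
    (ψ : (ℓ : ℕ) → (ZMod ℓ)ˣ →* Multiplicative (ZMod (2 ^ k))) :
    kuriharaNumberScaled f 1 k n ψ = kuriharaNumber f (2 ^ k) n ψ := by
  simp [kuriharaNumberScaled, kuriharaNumber_def]

/-- **A UNIT Kurihara witness at `2`** for `(W, f)`: a scaling `c ≠ 0` making all plus symbols `2`-integral, a level
`k ≥ 1`, a square-free product `n` of Kato–Kim Kolyvagin primes of level `k` at `p = 2`, surjective discrete logarithms,
and `δ^{(c)}_n ∈ (ℤ/2^k)ˣ`. NO Tamagawa/Kim level cap and NO image condition (contrast `SharpKuriharaWitnessAtTwo` of the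
19577 line on (α)): the error-blind lever only needs primitivity of Kato's Kolyvagin system modulo the maximal ideal. -/
def UnitKuriharaWitnessAtTwo (W : WeierstrassCurve ℚ) [W.IsElliptic] [W.IsGloballyMinimal]
    {N : ℕ} (f : CuspForm (Gamma0 N) 2) : Prop :=
  ∃ (c : ℚ) (k n : ℕ) (_ : NeZero n) (ψ : (ℓ : ℕ) → (ZMod ℓ)ˣ →* Multiplicative (ZMod (2 ^ k))),
    c ≠ 0 ∧ (∀ r : ℚ, ‖((c * ratPlusSymbol f r : ℚ) : ℚ_[2])‖ ≤ 1) ∧ 1 ≤ k ∧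
    Kato.IsKolyvaginProduct W 2 k n ∧ (∀ ℓ ∈ n.primeFactors, Function.Surjective (ψ ℓ)) ∧
    IsUnit (kuriharaNumberScaled f c k n ψ)

/-- **FIRST LEMMA (the lever, typed) — a unit witness kills the `λ` of Kato's cofactor, with 2-power slack.**
For non-CM `W` good ordinary at `2`, cyclotomic data, a newform `f` of `W`, a scalar `ϖ ≠ 0`, ANY dual datum `D` with
`char X = (f_X)` and ANY `d ∈ Λ`, `m ∈ ℕ` with `ι(f_X · d) = 2^m ϖ · L₂(f, α)` (Kato's divisibility in `Λ ⊗ ℚ`, Thm 17.4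
at every `p`, supplies such `(m, d)` with no image hypothesis): a unit Kurihara witness gives `λ(d) = 0` — `d` may be
`2^j · unit`; `μ` is not claimed. All ranks. Printed nowhere at `p = 2`; the `p`-odd residually-reducible template is the
Kolyvagin-system argument with error terms (CGLS 2022 §3; Castella 2024 §2.3). -/
def UnitWitnessKillsCofactorLambdaAtTwo : Prop :=
  ∀ (W : WeierstrassCurve ℚ) [W.IsElliptic] [W.IsGloballyMinimal], ¬ W.HasCM → GoodOrd W 2 →
    ∀ (κ : ZpExtension ℚ 2) (γ : Field.absoluteGaloisGroup ℚ),
      κ.IsCyclotomic → κ.IsTopGenerator γ → IsCyclotomicVariable 2 γ → IsOrdinaryAt W 2 →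
    ∀ [NeZero (W.conductorNorm ℤ)] (f : CuspForm (Gamma0 (W.conductorNorm ℤ)) 2), IsNewformOf W f →
    ∀ (ϖ : ℚ) (m : ℕ) (D : W.SelmerDualData κ γ) (fX d : IwasawaAlgebra 2), ϖ ≠ 0 →
      D.charIdeal = Ideal.span {fX} →
      iwasawaToPowerSeries 2 (fX * d) =
        PowerSeries.C (((2 : ℚ) ^ m * ϖ : ℚ) : ℚ_[2]) * padicLFunction f (unitRoot W 2 : ℚ_[2]) →
      UnitKuriharaWitnessAtTwo W f →
      Summit.BirchSwinnertonDyer.Rank1Residual.X1.MuLambda.lam d = 0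

/-- **TRANSFER `C⁺` (per curve, error-blind rigidity)**: a unit Kurihara witness for every newform of `W` forces the
`λ`-half at `W`. (`C⁺ ⟸ UnitWitnessKillsCofactorLambdaAtTwo` + Kato 17.4 (1)(2) at `2` + `λ(f_X d) = λ(f_X) + λ(d)`.) -/
def TwoPowerSlackRigidityAtTwo : Prop :=
  ∀ (W : WeierstrassCurve ℚ) [W.IsElliptic] [W.IsGloballyMinimal], ¬ W.HasCM → GoodOrd W 2 →
    (∀ [NeZero (W.conductorNorm ℤ)] (f : CuspForm (Gamma0 (W.conductorNorm ℤ)) 2), IsNewformOf W f →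
      UnitKuriharaWitnessAtTwo W f) →
    LambdaHalfAtTwo W

/-- **SUPPLY (finite certificate per curve, all ranks, no image condition)**: every non-CM good-ordinary-at-2 curve
carries a unit Kurihara witness at `2` for its newform (Kim: ⟺ Kato's Kolyvagin system is primitive mod `𝔪`). -/
def UnitKuriharaSupplyAtTwo : Prop :=
  ∀ (W : WeierstrassCurve ℚ) [W.IsElliptic] [W.IsGloballyMinimal], ¬ W.HasCM → GoodOrd W 2 →
    ∀ [NeZero (W.conductorNorm ℤ)] (f : CuspForm (Gamma0 (W.conductorNorm ℤ)) 2), IsNewformOf W f →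
      UnitKuriharaWitnessAtTwo W f

/-- Composition (kernel-checked, no `sorry`): supply ∧ error-blind rigidity ⟹ the crux BY NAME. -/
theorem ordLambdaHalfAtTwo_of (hS : UnitKuriharaSupplyAtTwo) (hR : TwoPowerSlackRigidityAtTwo) :
    Summit.BirchSwinnertonDyer.BirchSwinnertonDyer.Theses.TwoAdicConverse.OrdLambdaHalfAtTwo := by
  show Summit.BirchSwinnertonDyer.BirchSwinnertonDyer.Theorems.TwoAdicTwistConverse.OrdLambdaHalfAtTwo
  intro W _ _ hcm hgo
  exact hR W hcm hgo (fun f hf => hS W hcm hgo f hf)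

end Summit.BirchSwinnertonDyer.BirchSwinnertonDyer.Cruxes.OrdLambdaHalfAtTwo.TwoPowerSlackRigidityTwo

end
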